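/-
Copyright (c) 2026. All rights reserved.
Released under Apache 2.0 license as described in the file LICENSE.
Authors: abc-iut cell, prover seat abc-iut-w6-d031 (gen 5; PROOF-ONLY, classical complex analysis —
first half of the great Picard theorem via the modular function).
-/
import Literature.Analysis.Complex.UpperHalfPlaneTranslationEquivariant
import Literature.Analysis.Complex.MontelOmittingTwoValues
import Literature.NumberTheory.Automorphic.ModularLambdaCovering
import Literature.AnabelianGeometry.AbsoluteAnabelian.ArchimedeanHolFieldFunctorGeometricPSLGammaTwo
import Mathlib.Analysis.Convex.Contractible
import HarnessLib

/-!
# The `λ`-monodromy of a holomorphic map `𝔻* → ℂ ∖ {0, 1}` (great Picard, part 1)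

Classical (É. Picard 1879; L. V. Ahlfors, *Complex Analysis*, 3rd ed. (1979), Ch. 8 §3.4 «Picard's
theorem» via the modular function `λ`, Ch. 7 §3.4–3.5).  A holomorphic `f : 𝔻* → ℂ ∖ {0, 1}` unwinds on
the universal covering `w ↦ e^{2πiw}` of the punctured disc and lifts through the covering
`λ : ℍ → ℂ ∖ {0, 1}` (tree: `ModularLambda.isCoveringMap_modularLambda`,
`exists_lift_modularLambda_of_differentiableOn`) to a holomorphic `F : ℍₒ → ℍₒ` with
`λ ∘ F = f ∘ e^{2πi·}`; the deck transformation `w ↦ w + 1` is carried to an element `γ ∈ Γ(2)` with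
`F (w + 1) = γ · F w` — the **`λ`-MONODROMY** of `f` at the puncture.  This PROOF-ONLY file (no
definitions, no named facts) proves the DICHOTOMY that opens the great Picard theorem:

* ★ `GreatPicard.monodromy_dichotomy` — EITHER `f` has a limit `L ∈ ℂ ∖ {0, 1}` at `0` (removable
  singularity), OR the monodromy `γ ∈ Γ(2)` is PARABOLIC (exported with the lift `F`).
  The monodromy is never hyperbolic (abc-iut-w6-d031's `sq_trace_le_four_of_translationEquivariant`:
  Schwarz–Pick versus translation length), never elliptic (`Γ(2)` has even, non-zero traces —
  abc-iut-L4-d1's `HolRS.trace_ne_zero_of_mem_Gamma_two`), and if it is `±1` then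
  `F` is `1`-periodic, converges in `ℍₒ` at the cusp (`exists_limit_of_periodic_of_mapsTo`), and
  `f = λ ∘ F → λ(τ*)`.

The remaining PARABOLIC case (great Picard proper: `f → 0, 1` or `∞`, by the behaviour of `λ` at the
cusps of `Γ(2)`) is left to the successor file.  Nothing here is specific to the abc-iut cell; its use
there is hypothesis (FC) of the [AbsTopIII] Prop 4.2 (i) geometric column (cusps of the abstract deck
group ↔ punctures).

## References

* J. B. Conway, *Functions of One Complex Variable I*, GTM 11 (1978), Ch. XII Thm. 4.2 (the Great
  Picard Theorem). [Conway1978]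
* L. V. Ahlfors, *Complex Analysis*, 3rd ed., McGraw-Hill (1979), Ch. 8 §3.4, Ch. 7 §3.4–3.5.
  [Ahlfors1979]
* H. M. Farkas, I. Kra, *Riemann Surfaces*, 2nd ed. (1992), IV.5.5–IV.5.6. [FarkasKra1992]
-/

set_option autoImplicit false

noncomputable section

open Complex Filter Topology Metric Set Function
open scoped Real UpperHalfPlane MatrixGroups
open UpperHalfPlane (upperHalfPlaneSet isOpen_upperHalfPlaneSet)
open Literature.Analysis.Complex.TranslationEquivariant
open Literature.NumberTheory.Automorphic Literature.NumberTheory.Automorphic.ModularLambda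

namespace Literature.Analysis.Complex

namespace GreatPicard

/-! ### §1 Arithmetic of `Γ(2)`: even, non-zero traces -/

/-- **Traces in `Γ(2)` are even.** [cite: FarkasKra1992, IV.5.5–IV.5.6] -/
theorem two_dvd_trace_of_mem_Gamma_two {γ : SL(2, ℤ)} (hγ : γ ∈ CongruenceSubgroup.Gamma 2) :
    (2 : ℤ) ∣ (γ : Matrix (Fin 2) (Fin 2) ℤ) 0 0 + (γ : Matrix (Fin 2) (Fin 2) ℤ) 1 1 := by
  rw [CongruenceSubgroup.Gamma_mem] at hγ
  obtain ⟨h00, -, -, h11⟩ := hγ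
  have : (((γ : Matrix (Fin 2) (Fin 2) ℤ) 0 0 + (γ : Matrix (Fin 2) (Fin 2) ℤ) 1 1 : ℤ) : ZMod 2) = 0 := by
    push_cast
    rw [h00, h11]
    decide
  exact (ZMod.intCast_zmod_eq_zero_iff_dvd _ 2).mp this

/-- In `Γ(2)`, `(a + d)² ≤ 4` forces `(a + d)² = 4` (even, non-zero trace).
[cite: FarkasKra1992, IV.5.5–IV.5.6] -/
theorem sq_trace_eq_four_of_le {γ : SL(2, ℤ)} (hγ : γ ∈ CongruenceSubgroup.Gamma 2)
    (hle : ((γ : Matrix (Fin 2) (Fin 2) ℤ) 0 0 + (γ : Matrix (Fin 2) (Fin 2) ℤ) 1 1) ^ 2 ≤ 4) :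
    ((γ : Matrix (Fin 2) (Fin 2) ℤ) 0 0 + (γ : Matrix (Fin 2) (Fin 2) ℤ) 1 1) ^ 2 = 4 := by
  have h0 := Literature.AnabelianGeometry.AbsoluteAnabelian.HolRS.trace_ne_zero_of_mem_Gamma_two hγ
  obtain ⟨k, hk⟩ := two_dvd_trace_of_mem_Gamma_two hγ
  rw [hk] at hle h0 ⊢
  have hk0 : k ≠ 0 := fun h => h0 (by rw [h, mul_zero])
  have hk1 : k ^ 2 ≤ 1 := by nlinarith
  have hk2 : 1 ≤ k ^ 2 := by
    rcases lt_or_gt_of_ne hk0 with h | h <;> nlinarith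
  nlinarith

/-! ### §2 The `λ`-lift of `f ∘ e^{2πi·}` and its monodromy -/

/-- The open upper half-plane `ℍₒ ⊆ ℂ` is simply connected (convex). [folklore] -/
private theorem isSimplyConnected_upperHalfPlaneSet : IsSimplyConnected upperHalfPlaneSet := by
  haveI := (convex_halfSpace_im_gt (0 : ℝ)).contractibleSpace ⟨I, by simp⟩
  show SimplyConnectedSpace upperHalfPlaneSet
  infer_instance

/-- ★ **The `λ`-monodromy dichotomy (great Picard, part 1).**  Let `f` be holomorphic on the punctured
unit disc, omitting `0` and `1`.  Then EITHER `f (z) → L` as `z → 0` for some `L ∈ ℂ ∖ {0, 1}` (a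
removable singularity), OR there are a holomorphic `F : ℍₒ → ℍₒ` with `λ (F w) = f (e^{2πiw})` and a
PARABOLIC `γ ∈ Γ(2)` with `F (w + 1) = γ · F w` on `ℍₒ` — the `λ`-monodromy of `f` at the puncture.
(The monodromy `γ` always exists; it is not hyperbolic by Schwarz–Pick
(`sq_trace_le_four_of_translationEquivariant`), hence `(tr γ)² = 4` in `Γ(2)`; if `γ = ±1` the lift is
`1`-periodic and `f = λ ∘ F` converges at `0` by `exists_limit_of_periodic_of_mapsTo`.)
[cite: Conway1978, Ch. XII Thm. 4.2] [cite: Ahlfors1979, Ch. 8 §3.4] [cite: FarkasKra1992, IV.5.5–IV.5.6] -/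
theorem monodromy_dichotomy {f : ℂ → ℂ} (hf : DifferentiableOn ℂ f (ball (0 : ℂ) 1 \ {0}))
    (h0 : ∀ z ∈ ball (0 : ℂ) 1 \ {0}, f z ≠ 0) (h1 : ∀ z ∈ ball (0 : ℂ) 1 \ {0}, f z ≠ 1) :
    (∃ L : ℂ, L ≠ 0 ∧ L ≠ 1 ∧ Tendsto f (𝓝[≠] 0) (𝓝 L)) ∨
    ∃ (F : ℂ → ℂ) (γ : SL(2, ℤ)), γ ∈ CongruenceSubgroup.Gamma 2 ∧
      (γ : Matrix (Fin 2) (Fin 2) ℤ).IsParabolic ∧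
      DifferentiableOn ℂ F upperHalfPlaneSet ∧ MapsTo F upperHalfPlaneSet upperHalfPlaneSet ∧
      (∀ w : ℂ, 0 < w.im → modularLambda (F w) = f (exp (2 * π * I * w))) ∧
      ∀ w : ℂ, 0 < w.im → F (w + 1) =
        ((((γ : Matrix (Fin 2) (Fin 2) ℤ) 0 0 : ℤ) : ℝ) * F w + (((γ : Matrix (Fin 2) (Fin 2) ℤ) 0 1 : ℤ) : ℝ)) /
        ((((γ : Matrix (Fin 2) (Fin 2) ℤ) 1 0 : ℤ) : ℝ) * F w + (((γ : Matrix (Fin 2) (Fin 2) ℤ) 1 1 : ℤ) : ℝ)) := by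
  classical
  -- §a `g = f ∘ e^{2πi·}` on `ℍₒ`
  let E : ℂ → ℂ := fun w => exp (2 * π * I * w)
  have hE_diff : Differentiable ℂ E := differentiable_exp.comp ((differentiable_const _).mul differentiable_id)
  have hE_mem : ∀ w : ℂ, 0 < w.im → E w ∈ ball (0 : ℂ) 1 \ {0} := fun w hw => exp_mem_puncturedDisc hw
  let g : ℂ → ℂ := fun w => f (E w)
  have hg : DifferentiableOn ℂ g upperHalfPlaneSet :=
    hf.comp hE_diff.differentiableOn fun w hw => hE_mem w hw
  have hg0 : ∀ w ∈ upperHalfPlaneSet, g w ≠ 0 := fun w hw => h0 _ (hE_mem w hw)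
  have hg1 : ∀ w ∈ upperHalfPlaneSet, g w ≠ 1 := fun w hw => h1 _ (hE_mem w hw)
  have hgper : ∀ w : ℂ, g (w + 1) = g w := fun w => by
    show f (exp (2 * π * I * (w + 1))) = f (exp (2 * π * I * w))
    rw [mul_add, mul_one, Complex.exp_add, Complex.exp_two_pi_mul_I, mul_one]
  -- §b the holomorphic `λ`-lift `F : ℍₒ → ℍₒ`
  have hI : (I : ℂ) ∈ upperHalfPlaneSet := by show 0 < I.im; simp
  obtain ⟨τ₀, hτ₀, hτ₀g⟩ := exists_modularLambda_eq (hg0 I hI) (hg1 I hI)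
  obtain ⟨F, hFd, hFpos, -, hFlift⟩ := exists_lift_modularLambda_of_differentiableOn
    isOpen_upperHalfPlaneSet isSimplyConnected_upperHalfPlaneSet hI hτ₀ hg hg0 hg1 hτ₀g
  have hmaps : MapsTo F upperHalfPlaneSet upperHalfPlaneSet := fun w hw => hFpos w hw
  -- §c the monodromy `γ ∈ Γ(2)`: `F (w + 1) = γ • F w`
  let Fh : upperHalfPlaneSet → ℍ := fun u => UpperHalfPlane.mk (F u) (hFpos u u.2)
  have hmem1 : ∀ u : upperHalfPlaneSet, (u : ℂ) + 1 ∈ upperHalfPlaneSet := fun u => by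
    show 0 < ((u : ℂ) + 1).im
    simpa using (show 0 < (u : ℂ).im from u.2)
  let Fh1 : upperHalfPlaneSet → ℍ := fun u => UpperHalfPlane.mk (F (u + 1)) (hFpos _ (hmem1 u))
  have hFcont : ContinuousOn F upperHalfPlaneSet := hFd.continuousOn
  have hFh_cont : Continuous Fh := by
    rw [UpperHalfPlane.isEmbedding_coe.continuous_iff]
    exact hFcont.comp_continuous continuous_subtype_val fun u => u.2
  have hFh1_cont : Continuous Fh1 := by
    rw [UpperHalfPlane.isEmbedding_coe.continuous_iff]
    exact hFcont.comp_continuous (continuous_subtype_val.add continuous_const) hmem1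
  have hlam : ∀ u : upperHalfPlaneSet,
      modularLambda ((Fh1 u : ℍ) : ℂ) = modularLambda ((Fh u : ℍ) : ℂ) := fun u => by
    show modularLambda (F (u + 1)) = modularLambda (F u)
    rw [hFlift _ (hmem1 u), hFlift _ u.2, hgper]
  obtain ⟨γ, hγ, hγI⟩ :=
    (modularLambda_eq_modularLambda_iff (z₁ := Fh ⟨I, hI⟩) (z₂ := Fh1 ⟨I, hI⟩)).mp (hlam ⟨I, hI⟩).symm
  haveI : PreconnectedSpace upperHalfPlaneSet :=
    Subtype.preconnectedSpace (convex_halfSpace_im_gt (0 : ℝ)).isPreconnected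
  have hγsmul_cont : Continuous fun u : upperHalfPlaneSet => γ • Fh u :=
    (continuous_const_smul (Matrix.SpecialLinearGroup.mapGL ℝ γ : GL (Fin 2) ℝ)).comp hFh_cont
  have hdeck : ∀ u : upperHalfPlaneSet, Fh1 u = γ • Fh u := by
    have h := isCoveringMap_modularLambda.eq_of_comp_eq (g₁ := Fh1) (g₂ := fun u => γ • Fh u)
      hFh1_cont hγsmul_cont (funext fun u => Subtype.ext ?_) ⟨I, hI⟩ hγI.symm
    · exact fun u => congrFun h u
    · show modularLambda ((Fh1 u : ℍ) : ℂ) = modularLambda ((γ • Fh u : ℍ) : ℂ)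
      rw [modularLambda_smul hγ, hlam]
  -- the monodromy in coordinates
  set a : ℝ := (((γ : Matrix (Fin 2) (Fin 2) ℤ) 0 0 : ℤ) : ℝ) with ha
  set b : ℝ := (((γ : Matrix (Fin 2) (Fin 2) ℤ) 0 1 : ℤ) : ℝ) with hb
  set c : ℝ := (((γ : Matrix (Fin 2) (Fin 2) ℤ) 1 0 : ℤ) : ℝ) with hc
  set d : ℝ := (((γ : Matrix (Fin 2) (Fin 2) ℤ) 1 1 : ℤ) : ℝ) with hd
  have hdetZ := Matrix.SpecialLinearGroup.det_coe γ
  rw [Matrix.det_fin_two] at hdetZ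
  have had : a * d - b * c = 1 := by
    rw [ha, hb, hc, hd]
    exact_mod_cast hdetZ
  have heq : ∀ w : ℂ, 0 < w.im → F (w + 1) = ((a : ℂ) * F w + b) / ((c : ℂ) * F w + d) := by
    intro w hw
    have h := congrArg (fun z : ℍ => (z : ℂ)) (hdeck ⟨w, hw⟩)
    simp only [Fh1, Fh, UpperHalfPlane.coe_specialLinearGroup_apply, eq_intCast] at h
    rw [h, ha, hb, hc, hd]
  -- §d not hyperbolic, hence `(tr γ)² = 4`
  have hle : (a + d) ^ 2 ≤ 4 := sq_trace_le_four_of_translationEquivariant hFd hmaps had heq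
  have hleZ : ((γ : Matrix (Fin 2) (Fin 2) ℤ) 0 0 + (γ : Matrix (Fin 2) (Fin 2) ℤ) 1 1) ^ 2 ≤ 4 := by
    have : ((((γ : Matrix (Fin 2) (Fin 2) ℤ) 0 0 + (γ : Matrix (Fin 2) (Fin 2) ℤ) 1 1) ^ 2 : ℤ) : ℝ) ≤ 4 := by
      push_cast; rw [ha, hd] at hle; exact hle
    exact_mod_cast this
  have hsq := sq_trace_eq_four_of_le hγ hleZ
  -- §e dichotomy on `γ` scalar
  by_cases hscal : (γ : Matrix (Fin 2) (Fin 2) ℤ) ∈ Set.range (Matrix.scalar (Fin 2))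
  · -- `γ = ±1`: trivial monodromy, `F` is `1`-periodic
    left
    obtain ⟨r, hr⟩ := hscal
    have h00 : (γ : Matrix (Fin 2) (Fin 2) ℤ) 0 0 = r := by
      rw [← hr, Matrix.scalar_apply, Matrix.diagonal_apply_eq]
    have h01 : (γ : Matrix (Fin 2) (Fin 2) ℤ) 0 1 = 0 := by
      rw [← hr, Matrix.scalar_apply, Matrix.diagonal_apply_ne _ (by decide)]
    have h10 : (γ : Matrix (Fin 2) (Fin 2) ℤ) 1 0 = 0 := by
      rw [← hr, Matrix.scalar_apply, Matrix.diagonal_apply_ne _ (by decide)]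
    have h11 : (γ : Matrix (Fin 2) (Fin 2) ℤ) 1 1 = r := by
      rw [← hr, Matrix.scalar_apply, Matrix.diagonal_apply_eq]
    have hr0 : (r : ℝ) ≠ 0 := by
      have h' := hdetZ
      rw [h00, h01, h10, h11] at h'
      have : r ≠ 0 := fun h => by rw [h] at h'; simp at h'
      exact_mod_cast this
    have hper : ∀ w : ℂ, 0 < w.im → F (w + 1) = F w := fun w hw => by
      rw [heq w hw, ha, hb, hc, hd, h00, h01, h10, h11]
      push_cast
      have hrC : ((r : ℤ) : ℂ) ≠ 0 := by exact_mod_cast (show (r : ℤ) ≠ 0 by exact_mod_cast hr0)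
      rw [add_zero, zero_mul, zero_add, mul_div_cancel_left₀ (F w) hrC]
    obtain ⟨τs, hτs, hlim⟩ := exists_limit_of_periodic_of_mapsTo hFd hmaps hper
    refine ⟨modularLambda τs, modularLambda_ne_zero hτs, modularLambda_ne_one hτs, ?_⟩
    rw [Metric.tendsto_nhdsWithin_nhds]
    intro ε hε
    obtain ⟨η, hη, hηε⟩ := Metric.continuousAt_iff.mp
      (differentiableAt_modularLambda hτs).continuousAt ε hε
    obtain ⟨A, hA⟩ := hlim η hη
    -- points `z` with `0 < ‖z‖ < e^{-2π A'}` come from `w = log z / 2πi` with `Im w > A' ≥ A`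
    set A' : ℝ := max A 0 + 1 with hA'
    refine ⟨Real.exp (-2 * π * A'), Real.exp_pos _, fun {z} hz0 hzδ => ?_⟩
    have hz0' : z ≠ 0 := hz0
    rw [dist_zero_right] at hzδ
    set w : ℂ := log z / (2 * π * I) with hw
    have hwim : w.im = -Real.log ‖z‖ / (2 * π) := by
      have hre : (2 * π * I : ℂ).re = 0 := by simp
      have him : (2 * π * I : ℂ).im = 2 * π := by simp
      have hn : Complex.normSq (2 * π * I : ℂ) = (2 * π) ^ 2 := by
        rw [Complex.normSq_apply, hre, him]; ring
      rw [hw, Complex.div_im, hre, him, hn, Complex.log_re]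
      have hπ : (2 * π) ≠ 0 := by positivity
      field_simp
      ring
    have hlogz : Real.log ‖z‖ < -2 * π * A' := by
      rw [← Real.exp_lt_exp, Real.exp_log (norm_pos_iff.mpr hz0')]
      exact hzδ
    have hwA' : A' < w.im := by
      rw [hwim, lt_div_iff₀ (by positivity)]
      linarith
    have hw0 : 0 < w.im := by
      have : 0 < A' := by rw [hA']; linarith [le_max_right A 0]
      linarith
    have hwA : A < w.im := by
      have : A < A' := by rw [hA']; linarith [le_max_left A 0]
      linarith
    have hEw : exp (2 * π * I * w) = z := exp_logBranch hz0'
    have hfz : f z = modularLambda (F w) := by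
      have h' : modularLambda (F w) = f (exp (2 * π * I * w)) := hFlift w hw0
      rw [← hEw]
      exact h'.symm
    rw [hfz]
    exact hηε (by rw [dist_eq_norm]; exact hA w hwA)
  · right
    exact ⟨F, γ, hγ, ⟨hscal, by rw [Matrix.discr_fin_two, Matrix.trace_fin_two,
      Matrix.SpecialLinearGroup.det_coe]; linarith⟩, hFd, hmaps, fun w hw => hFlift w hw, heq⟩

end GreatPicard

end Literature.Analysis.Complex

end
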